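import Summits.Ventures.YMGap.RobustBall.MassGapOnBallZdW
import HarnessLib

/-!
# Venture YMGap, track ROBUST-BALL (Y2) — crux Y2-X2-WZd, step 2: the FAR ENERGY of a vertex star and the
# kernel split `γ^W_⋆ = (γ^{trunc}_⋆) tilted by the far energy`

HONEST FRAMING. WHAT THIS IS: a venture file (cell `pub-ymgap`, track Y2 ROBUST-BALL, seat ds-2). For a
link-summable potential `W` on `ℤ^d`, a vertex `s` and a box radius `D`, the terms meeting a volume `Λ` split into
the NEAR ones (inside the box `starNbhdZdR D s`; they form the truncation `truncZd D s W`, a TIER-1 object) and the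
FAR ones; the far energy `farEnergyZd D s Λ W = Σ'_{X ∩ Λ ≠ ∅, X ⊄ box} W_X` is an absolutely convergent series and
* `perturbedYMS_eq_tilted_truncZd` — rb-p1's summable kernel is the TIER-1 kernel of the truncation tilted by minus
  the far energy: `perturbedYMS ρ β W Λ η = (perturbedYM ρ β (truncZd D s W) (truncSuppZd D s) Λ η).tilted (−far)`
  (Mathlib `tilted_tilted`);
* `abs_farEnergyZd_sub_le_link` — the far energy is Lipschitz in every link `x` with constant
  `ℓ_x = Σ'_{far X ∋ x} lip_X(x)`;
* `abs_farEnergyZd_piecewise_sub_le` — changing the EXTERIOR field from `ω` to `η` (inside `Λ` frozen to `σ`) moves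
  the far energy by at most `Σ'_y L_y · r(ω_y, η_y)`, `L_y = Σ'_{far X ∋ y, y ∉ Λ} lip_X(y)` (Fubini for the
  nonnegative double series);
* for a member of the diameter-weighted ball `MemBallZdW κ ε₀ ε₁` and `Λ` = the star of `s`: every far set has
  diameter `≥ D`, so `ℓ_x ≤ e^{−κD} ε₁`, and the reach-weighted exterior constant is
  `Σ'_y L_y e^{t(‖y−s‖+1)} ≤ (d+1) e^{2t} e^{−(κ−t)D} ε₁` (`0 ≤ t ≤ κ`) — the far family is invisible for large `D`.
Pure bookkeeping feeding the tier-2 `ℤ^d` star door (`RobustStarDoorZdW.lean`). WHAT THIS IS NOT: no door, no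
number; nothing about the continuum or the Millennium problem.
-/

noncomputable section

open MeasureTheory Function Finset Real
open scoped NNReal
open Literature.Probability.LatticeModels
open Literature.Probability.LatticeModels.DobrushinMetric
open Literature.MathematicalPhysics.QuantumLattice
open Literature.MathematicalPhysics.QuantumFieldTheory hiding ZdEdge
open Summit.Ventures.YMGap.DSWindowZd

namespace Summit.Ventures.YMGap.RobustBall

variable {d N : ℕ}

/-! ### The far energy: definition and summability -/

/-- **The far energy** of the volume `Λ` relative to the radius-`D` box around `s`: the series of the terms of
the link sets meeting `Λ` but NOT inside the box. [folklore] -/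
def farEnergyZd (D : ℕ) (s : Site d) (Λ : Finset (ZdEdge d)) (W : Potential (ZdEdge d) (SUN N))
    (U : LGConfig d (SUN N)) : ℝ :=
  ∑' X : Finset (ZdEdge d), (if (X ∩ Λ).Nonempty ∧ ¬ X ⊆ starNbhdZdR D s then W X U else 0)

variable {W : Potential (ZdEdge d) (SUN N)} {Bm : Finset (ZdEdge d) → ℝ}

/-- The far terms are dominated by the volume terms, hence summable. [folklore] -/
theorem summable_farTerm (h : IsLinkSummable W Bm) (D : ℕ) (s : Site d) (Λ : Finset (ZdEdge d))
    (U : LGConfig d (SUN N)) :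
    Summable fun X : Finset (ZdEdge d) =>
      (if (X ∩ Λ).Nonempty ∧ ¬ X ⊆ starNbhdZdR D s then W X U else 0) := by
  haveI : Nonempty (LGConfig d (SUN N)) := ⟨fun _ => 1⟩
  refine Summable.of_norm_bounded (h.summable_term Λ U).norm fun X => ?_
  rw [Real.norm_eq_abs, Real.norm_eq_abs]
  by_cases h1 : (X ∩ Λ).Nonempty
  · by_cases h2 : X ⊆ starNbhdZdR D s
    · rw [if_neg (fun h => h.2 h2), if_pos h1, abs_zero]; exact abs_nonneg _
    · rw [if_pos ⟨h1, h2⟩, if_pos h1]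
  · rw [if_neg (fun h => h1 h.1), if_neg h1]

/-- The near terms form the tier-1 Hamiltonian of the truncation. [folklore] -/
theorem hamiltonianIn_truncZd_eq_tsum (D : ℕ) (s : Site d) (Λ : Finset (ZdEdge d)) (U : LGConfig d (SUN N)) :
    hamiltonianIn (truncZd D s W) (truncSuppZd D s) Λ U =
      ∑' X : Finset (ZdEdge d), (if (X ∩ Λ).Nonempty ∧ X ⊆ starNbhdZdR D s then W X U else 0) := by
  classical
  unfold hamiltonianIn
  rw [tsum_eq_sum (s := truncSuppZd D s Λ) (fun X hX => ?_)]
  · rw [Finset.sum_filter]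
    refine Finset.sum_congr rfl fun X hX => ?_
    obtain ⟨hXs, hXΛ⟩ := mem_truncSuppZd.1 hX
    rw [if_pos hXΛ, if_pos ⟨hXΛ, hXs⟩, truncZd_of_subset hXs]
  · rw [if_neg]
    exact fun h => hX (mem_truncSuppZd.2 ⟨h.2, h.1⟩)

/-- **Near/far split of the volume series**: `Σ'_{X ∩ Λ ≠ ∅} W_X = H^{trunc}_Λ + far`. [folklore] -/
theorem tsum_volume_eq_hamiltonianIn_add_far (h : IsLinkSummable W Bm) (D : ℕ) (s : Site d)
    (Λ : Finset (ZdEdge d)) (U : LGConfig d (SUN N)) :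
    ∑' X : Finset (ZdEdge d), (if (X ∩ Λ).Nonempty then W X U else 0) =
      hamiltonianIn (truncZd D s W) (truncSuppZd D s) Λ U + farEnergyZd D s Λ W U := by
  classical
  rw [hamiltonianIn_truncZd_eq_tsum, farEnergyZd]
  have hnear : Summable fun X : Finset (ZdEdge d) =>
      (if (X ∩ Λ).Nonempty ∧ X ⊆ starNbhdZdR D s then W X U else 0) := by
    refine summable_of_ne_finset_zero (s := (starNbhdZdR D s).powerset) fun X hX => ?_
    rw [if_neg]
    exact fun h => hX (Finset.mem_powerset.2 h.2)
  rw [← hnear.tsum_add (summable_farTerm h D s Λ U)]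
  refine tsum_congr fun X => ?_
  by_cases h1 : (X ∩ Λ).Nonempty
  · by_cases h2 : X ⊆ starNbhdZdR D s
    · rw [if_pos h1, if_pos ⟨h1, h2⟩, if_neg (fun h => h.2 h2), add_zero]
    · rw [if_pos h1, if_neg (fun h => h2 h.2), if_pos ⟨h1, h2⟩, zero_add]
  · rw [if_neg h1, if_neg (fun h => h1 h.1), if_neg (fun h => h1 h.1), add_zero]

/-- The far energy is continuous (a series of continuous functions with summable sup-norm majorant,
Mathlib `continuous_tsum`). [folklore] -/
theorem continuous_farEnergyZd (h : IsLinkSummable W Bm) (hWc : ∀ X, Continuous (W X)) (D : ℕ) (s : Site d)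
    (Λ : Finset (ZdEdge d)) : Continuous (farEnergyZd D s Λ W) := by
  haveI : Nonempty (LGConfig d (SUN N)) := ⟨fun _ => 1⟩
  unfold farEnergyZd
  refine continuous_tsum (u := fun X => ∑ e ∈ Λ, (if e ∈ X then Bm X else 0)) (fun X => ?_)
    (h.summable_volume Λ) fun X U => ?_
  · by_cases hX : (X ∩ Λ).Nonempty ∧ ¬ X ⊆ starNbhdZdR D s
    · simp only [if_pos hX]; exact hWc X
    · simp only [if_neg hX]; exact continuous_const
  · rw [Real.norm_eq_abs]
    refine le_trans ?_ (h.abs_term_le Λ X U)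
    by_cases h1 : (X ∩ Λ).Nonempty
    · by_cases h2 : X ⊆ starNbhdZdR D s
      · rw [if_neg (fun h => h.2 h2), if_pos h1, abs_zero]; exact abs_nonneg _
      · rw [if_pos ⟨h1, h2⟩, if_pos h1]
    · rw [if_neg (fun h => h1 h.1), if_neg h1]

/-! ### The kernel split -/

section Split

variable (ρ : SUN N →* Matrix (Fin N) (Fin N) ℂ)

/-- **The summable energy is the tier-1 energy of the truncation minus the far energy.** [folklore] -/
theorem perturbedEnergyS_eq_truncZd_sub_far (h : IsLinkSummable W Bm) (β : ℝ) (D : ℕ) (s : Site d)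
    (Λ : Finset (ZdEdge d)) (U : LGConfig d (SUN N)) :
    perturbedEnergyS ρ β W Λ U =
      perturbedEnergy ρ β (truncZd D s W) (truncSuppZd D s) Λ U + -farEnergyZd D s Λ W U := by
  unfold perturbedEnergyS perturbedEnergy
  rw [tsum_volume_eq_hamiltonianIn_add_far h D s Λ U]
  ring

/-- **THE KERNEL SPLIT**: rb-p1's summable kernel of `W` in the volume `Λ` is the tier-1 kernel of the
truncation `truncZd D s W` tilted by minus the far energy (Mathlib `tilted_tilted`; the tier-1 energy is bounded
on the compact configuration space). [folklore] -/
theorem perturbedYMS_eq_tilted_truncZd (hρ : Continuous ρ) (h : IsLinkSummable W Bm) (hWc : ∀ X, Continuous (W X))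
    (β : ℝ) (D : ℕ) (s : Site d) (Λ : Finset (ZdEdge d)) (η : LGConfig d (SUN N)) :
    perturbedYMS (d := d) ρ β W Λ η =
      (perturbedYM (d := d) ρ β (truncZd D s W) (truncSuppZd D s) Λ η).tilted
        fun U => -farEnergyZd D s Λ W U := by
  have hWb : ∀ X, ∃ C, ∀ U, |truncZd D s W X U| ≤ C := fun X => by
    by_cases hX : X ⊆ starNbhdZdR D s
    · rw [truncZd_of_subset hX]; exact exists_bound_of_continuous (hWc X)
    · rw [truncZd_of_not_subset hX]; exact ⟨0, fun U => by simp⟩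
  obtain ⟨C, hC⟩ := exists_abs_perturbedEnergy_le ρ hρ β hWb (truncSuppZd D s) Λ
  haveI : IsProbabilityMeasure (((Measure.pi fun _ : ↥Λ => haarProbability (SUN N))).map (glueWith Λ · η)) :=
    Measure.isProbabilityMeasure_map (measurable_glueWith Λ η).aemeasurable
  have hWm : ∀ X, Measurable (truncZd D s W X) := fun X => by
    by_cases hX : X ⊆ starNbhdZdR D s
    · rw [truncZd_of_subset hX]; exact (hWc X).measurable
    · rw [truncZd_of_not_subset hX]; exact measurable_const
  have hint : Integrable (fun U : LGConfig d (SUN N) =>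
      Real.exp (perturbedEnergy ρ β (truncZd D s W) (truncSuppZd D s) Λ U))
      (((Measure.pi fun _ : ↥Λ => haarProbability (SUN N))).map (glueWith Λ · η)) := by
    refine integrable_of_abs_le' ((measurable_perturbedEnergy ρ hρ β hWm (truncSuppZd D s) Λ).exp)
      (M := Real.exp C) fun U => ?_
    rw [abs_of_pos (Real.exp_pos _)]
    exact Real.exp_le_exp.2 ((le_abs_self _).trans (hC U))
  have hE : perturbedEnergyS ρ β W Λ =
      perturbedEnergy ρ β (truncZd D s W) (truncSuppZd D s) Λ + fun U => -farEnergyZd D s Λ W U := by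
    funext U
    rw [Pi.add_apply]
    exact perturbedEnergyS_eq_truncZd_sub_far ρ h β D s Λ U
  unfold perturbedYMS perturbedYM
  rw [hE, tilted_tilted hint]

end Split

/-! ### Lipschitz bounds of the far energy -/

/-- `|Σ' f| ≤ Σ' g` when `|f| ≤ g` termwise and both series converge. [folklore] -/
private theorem abs_tsum_le_of_le {ι : Type*} {f g : ι → ℝ} (hfg : ∀ i, |f i| ≤ g i)
    (hg : Summable g) : |∑' i, f i| ≤ ∑' i, g i := by
  have hn : Summable fun i => ‖f i‖ :=
    Summable.of_nonneg_of_le (fun i => norm_nonneg _) (fun i => by rw [Real.norm_eq_abs]; exact hfg i) hg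
  calc |∑' i, f i| = ‖∑' i, f i‖ := (Real.norm_eq_abs _).symm
    _ ≤ ∑' i, ‖f i‖ := norm_tsum_le_tsum_norm hn
    _ ≤ ∑' i, g i := hn.tsum_le_tsum (fun i => by rw [Real.norm_eq_abs]; exact hfg i) hg

section Lipschitz

variable {lip : Finset (ZdEdge d) → ZdEdge d → ℝ}

/-- **The far energy is Lipschitz in every link** `x`, with constant `ℓ_x = Σ'_{far X ∋ x} lip_X(x)`: for `σ = τ`
off `x`, `|far σ − far τ| ≤ ℓ_x · d_F(σ_x, τ_x)`. [folklore] -/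
theorem abs_farEnergyZd_sub_le_link (h : IsLinkSummable W Bm) (hWdep : ∀ X, DependsOn (W X) (↑X : Set (ZdEdge d)))
    (hlip : ∀ X, IsLipBound suFrobDist (W X) (lip X)) (D : ℕ) (s : Site d) (Λ : Finset (ZdEdge d))
    {x : ZdEdge d}
    (hℓ : Summable fun X : Finset (ZdEdge d) =>
      (if ((X ∩ Λ).Nonempty ∧ ¬ X ⊆ starNbhdZdR D s) ∧ x ∈ X then lip X x else 0))
    {σ τ : LGConfig d (SUN N)} (hστ : ∀ z, z ≠ x → σ z = τ z) :
    |farEnergyZd D s Λ W σ - farEnergyZd D s Λ W τ| ≤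
      (∑' X : Finset (ZdEdge d),
        (if ((X ∩ Λ).Nonempty ∧ ¬ X ⊆ starNbhdZdR D s) ∧ x ∈ X then lip X x else 0)) *
        suFrobDist (σ x) (τ x) := by
  classical
  have hsσ := summable_farTerm h D s Λ σ
  have hsτ := summable_farTerm h D s Λ τ
  unfold farEnergyZd
  rw [← hsσ.tsum_sub hsτ, ← tsum_mul_right]
  -- termwise bound
  have hterm : ∀ X : Finset (ZdEdge d),
      |(if (X ∩ Λ).Nonempty ∧ ¬ X ⊆ starNbhdZdR D s then W X σ else 0) -
          (if (X ∩ Λ).Nonempty ∧ ¬ X ⊆ starNbhdZdR D s then W X τ else 0)| ≤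
        (if ((X ∩ Λ).Nonempty ∧ ¬ X ⊆ starNbhdZdR D s) ∧ x ∈ X then lip X x else 0) *
          suFrobDist (σ x) (τ x) := by
    intro X
    by_cases hF : (X ∩ Λ).Nonempty ∧ ¬ X ⊆ starNbhdZdR D s
    · rw [if_pos hF, if_pos hF]
      by_cases hx : x ∈ X
      · rw [if_pos ⟨hF, hx⟩]; exact (hlip X).le x σ τ hστ
      · rw [if_neg (fun h => hx h.2), zero_mul]
        rw [hWdep X (fun z hz => hστ z fun hzx => hx (hzx ▸ Finset.mem_coe.1 hz)), sub_self, abs_zero]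
    · rw [if_neg hF, if_neg hF, if_neg (fun h => hF h.1), sub_self, abs_zero, zero_mul]
  have hsg : Summable fun X : Finset (ZdEdge d) =>
      (if ((X ∩ Λ).Nonempty ∧ ¬ X ⊆ starNbhdZdR D s) ∧ x ∈ X then lip X x else 0) * suFrobDist (σ x) (τ x) :=
    hℓ.mul_right _
  exact abs_tsum_le_of_le hterm hsg

/-- **Changing the exterior field moves the far energy by the exterior Lipschitz series**: for the
configuration `Λ.piecewise σ ω` (inside `Λ` from `σ`, outside from `ω`) and any two exteriors `ω, η`,
`|far(σ_Λ ω) − far(σ_Λ η)| ≤ Σ'_y L_y r(ω_y, η_y)`, `L_y = Σ'_{far X ∋ y, y ∉ Λ} lip_X(y)` (termwise interpolation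
`abs_sub_le_sum_of_dependsOn`, then Fubini for the nonnegative double series). [folklore] -/
theorem abs_farEnergyZd_piecewise_sub_le (h : IsLinkSummable W Bm)
    (hWdep : ∀ X, DependsOn (W X) (↑X : Set (ZdEdge d))) (hlip : ∀ X, IsLipBound suFrobDist (W X) (lip X))
    (D : ℕ) (s : Site d) (Λ : Finset (ZdEdge d))
    (hL : Summable fun X : Finset (ZdEdge d) =>
      (if (X ∩ Λ).Nonempty ∧ ¬ X ⊆ starNbhdZdR D s then ∑ y ∈ X, lip X y else 0))
    (σ ω η : LGConfig d (SUN N)) :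
    |farEnergyZd D s Λ W (Λ.piecewise σ ω) - farEnergyZd D s Λ W (Λ.piecewise σ η)| ≤
      ∑' y : ZdEdge d, (∑' X : Finset (ZdEdge d),
        (if ((X ∩ Λ).Nonempty ∧ ¬ X ⊆ starNbhdZdR D s) ∧ y ∈ X ∧ y ∉ Λ then lip X y else 0)) *
          suFrobDist (ω y) (η y) := by
  classical
  set pω := Λ.piecewise σ ω with hpω
  set pη := Λ.piecewise σ η with hpη
  -- the nonnegative double family
  set F : Finset (ZdEdge d) → ZdEdge d → ℝ := fun X y =>
    if ((X ∩ Λ).Nonempty ∧ ¬ X ⊆ starNbhdZdR D s) ∧ y ∈ X ∧ y ∉ Λ then lip X y * suFrobDist (ω y) (η y) else 0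
    with hF
  have hF0 : ∀ X y, 0 ≤ F X y := fun X y => by
    simp only [hF]; split_ifs; exacts [mul_nonneg ((hlip X).nonneg y) (suFrobDist_nonneg _ _), le_rfl]
  have hR : ∀ a b : SUN N, suFrobDist a b ≤ 2 * Real.sqrt N := suFrobDist_le
  -- inner sums are finite
  have hFin : ∀ X, ∑' y, F X y = ∑ y ∈ X, F X y := fun X =>
    tsum_eq_sum (s := X) fun y hy => by simp only [hF]; rw [if_neg (fun h => hy h.2.1)]
  have hFle : ∀ X, ∑ y ∈ X, F X y ≤
      (if (X ∩ Λ).Nonempty ∧ ¬ X ⊆ starNbhdZdR D s then ∑ y ∈ X, lip X y else 0) * (2 * Real.sqrt N) := by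
    intro X
    by_cases hX : (X ∩ Λ).Nonempty ∧ ¬ X ⊆ starNbhdZdR D s
    · rw [if_pos hX, Finset.sum_mul]
      refine Finset.sum_le_sum fun y hy => ?_
      simp only [hF]
      split_ifs
      · exact mul_le_mul_of_nonneg_left (hR _ _) ((hlip X).nonneg y)
      · exact mul_nonneg ((hlip X).nonneg y) (by positivity)
    · rw [if_neg hX, zero_mul]
      refine (Finset.sum_eq_zero fun y hy => ?_).le
      simp only [hF]; rw [if_neg (fun h => hX h.1)]
  have hsumX : Summable fun X => ∑' y, F X y := by
    simp_rw [hFin]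
    exact Summable.of_nonneg_of_le (fun X => Finset.sum_nonneg fun y _ => hF0 X y) hFle (hL.mul_right _)
  have hunc : Summable (Function.uncurry F) :=
    (summable_prod_of_nonneg fun p => hF0 p.1 p.2).2
      ⟨fun X => summable_of_ne_finset_zero (s := X) fun y hy => by
        show F X y = 0; simp only [hF]; rw [if_neg (fun h => hy h.2.1)], hsumX⟩
  -- termwise interpolation
  have hterm : ∀ X : Finset (ZdEdge d),
      |(if (X ∩ Λ).Nonempty ∧ ¬ X ⊆ starNbhdZdR D s then W X pω else 0) -
          (if (X ∩ Λ).Nonempty ∧ ¬ X ⊆ starNbhdZdR D s then W X pη else 0)| ≤ ∑' y, F X y := by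
    intro X
    rw [hFin X]
    by_cases hX : (X ∩ Λ).Nonempty ∧ ¬ X ⊆ starNbhdZdR D s
    · rw [if_pos hX, if_pos hX]
      refine (abs_sub_le_sum_of_dependsOn (hWdep X) (hlip X) pω pη).trans (Finset.sum_le_sum fun y hy => ?_)
      simp only [hF]
      by_cases hyΛ : y ∈ Λ
      · rw [if_neg (fun h => h.2.2 hyΛ), hpω, hpη, Finset.piecewise_eq_of_mem _ _ _ hyΛ,
          Finset.piecewise_eq_of_mem _ _ _ hyΛ, suFrobDist_self, mul_zero]
      · rw [if_pos ⟨hX, hy, hyΛ⟩, hpω, hpη, Finset.piecewise_eq_of_notMem _ _ _ hyΛ,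
          Finset.piecewise_eq_of_notMem _ _ _ hyΛ]
    · rw [if_neg hX, if_neg hX, sub_self, abs_zero]
      exact Finset.sum_nonneg fun y _ => hF0 X y
  have hsσ := summable_farTerm h D s Λ pω
  have hsτ := summable_farTerm h D s Λ pη
  unfold farEnergyZd
  rw [← hsσ.tsum_sub hsτ]
  refine (abs_tsum_le_of_le hterm hsumX).trans (le_of_eq ?_)
  -- Fubini: `Σ'_X Σ'_y F X y = Σ'_y Σ'_X F X y = Σ'_y L_y · r_y`
  rw [← hunc.tsum_comm]
  refine tsum_congr fun y => ?_
  rw [← tsum_mul_right]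
  refine tsum_congr fun X => ?_
  simp only [hF]
  split_ifs <;> simp

end Lipschitz

/-! ### Load consequences for a member of the diameter-weighted ball, `Λ` = the star of `s` -/

section Loads

variable {κ ε₀ ε₁ : ℝ} {osc lip : Finset (ZdEdge d) → ZdEdge d → ℝ}

/-- A set meeting the star of `s` is based at `s` or at one of the `d` sites `s − e_μ`. [folklore] -/
theorem exists_base_of_meets_star {s : Site d} {X : Finset (ZdEdge d)} (hX : (X ∩ vertexStarZd s).Nonempty) :
    ∃ v ∈ insert s (Finset.univ.image fun μ : Fin d => s - Pi.single μ 1), ∃ μ : Fin d, ((v, μ) : ZdEdge d) ∈ X := by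
  obtain ⟨x, hx⟩ := hX
  rw [Finset.mem_inter] at hx
  rcases mem_vertexStarZd.1 hx.2 with h | h
  · refine ⟨s, Finset.mem_insert_self _ _, x.2, ?_⟩
    have : ((s, x.2) : ZdEdge d) = x := by rw [h]
    rw [this]; exact hx.1
  · refine ⟨s - Pi.single x.2 1, Finset.mem_insert_of_mem (Finset.mem_image.2 ⟨x.2, Finset.mem_univ _, rfl⟩),
      x.2, ?_⟩
    have : ((s - Pi.single x.2 1, x.2) : ZdEdge d) = x := by rw [h, add_sub_cancel_right]
    rw [this]; exact hx.1

/-- **The weighted Lipschitz mass of the sets meeting the star of `s` is at most `(d+1) ε₁`** (each such set is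
based at one of the `d+1` sites `s, s − e_μ`; site-incidence loads of `MemBallZdW`). [folklore] -/
theorem tsum_meets_star_weighted_lip_le {W : Potential (ZdEdge d) (SUN N)}
    (hlip : ∀ X, IsLipBound suFrobDist (W X) (lip X))
    (hlips : ∀ v : Site d, Summable fun X : Finset (ZdEdge d) =>
      (if (∃ μ : Fin d, ((v, μ) : ZdEdge d) ∈ X) then Real.exp (κ * linkDiamZd X) * ∑ y ∈ X, lip X y else 0))
    (hlipa : ∀ v : Site d, ∑' X : Finset (ZdEdge d),
      (if (∃ μ : Fin d, ((v, μ) : ZdEdge d) ∈ X) then Real.exp (κ * linkDiamZd X) * ∑ y ∈ X, lip X y else 0) ≤ ε₁)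
    (s : Site d) :
    (Summable fun X : Finset (ZdEdge d) =>
      (if (X ∩ vertexStarZd s).Nonempty then Real.exp (κ * linkDiamZd X) * ∑ y ∈ X, lip X y else 0)) ∧
    ∑' X : Finset (ZdEdge d),
      (if (X ∩ vertexStarZd s).Nonempty then Real.exp (κ * linkDiamZd X) * ∑ y ∈ X, lip X y else 0) ≤
        ((d : ℝ) + 1) * ε₁ := by
  classical
  set S : Finset (Site d) := insert s (Finset.univ.image fun μ : Fin d => s - Pi.single μ 1) with hS
  set g : Finset (ZdEdge d) → ℝ := fun X => Real.exp (κ * linkDiamZd X) * ∑ y ∈ X, lip X y with hg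
  have hg0 : ∀ X, 0 ≤ g X := fun X => mul_nonneg (Real.exp_nonneg _) (Finset.sum_nonneg fun y _ => (hlip X).nonneg y)
  -- domination by the sum over the `d+1` base sites
  have hdom : ∀ X, (if (X ∩ vertexStarZd s).Nonempty then g X else 0) ≤
      ∑ v ∈ S, (if (∃ μ : Fin d, ((v, μ) : ZdEdge d) ∈ X) then g X else 0) := by
    intro X
    split_ifs with hX
    · obtain ⟨v, hv, μ, hμ⟩ := exists_base_of_meets_star hX
      refine le_trans ?_ (Finset.single_le_sum (f := fun v => if (∃ μ : Fin d, ((v, μ) : ZdEdge d) ∈ X) then g X else 0)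
        (fun v _ => by split_ifs; exacts [hg0 X, le_rfl]) hv)
      simp only [if_pos (⟨μ, hμ⟩ : ∃ μ : Fin d, ((v, μ) : ZdEdge d) ∈ X), le_refl]
    · exact Finset.sum_nonneg fun v _ => by split_ifs; exacts [hg0 X, le_rfl]
  have hsumS : Summable fun X => ∑ v ∈ S, (if (∃ μ : Fin d, ((v, μ) : ZdEdge d) ∈ X) then g X else 0) :=
    summable_sum fun v _ => hlips v
  have h1 : Summable fun X : Finset (ZdEdge d) => (if (X ∩ vertexStarZd s).Nonempty then g X else 0) :=
    Summable.of_nonneg_of_le (fun X => by split_ifs; exacts [hg0 X, le_rfl]) hdom hsumS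
  refine ⟨h1, ?_⟩
  have hcard : (S.card : ℝ) ≤ (d : ℝ) + 1 := by
    have h := Finset.card_insert_le s (Finset.univ.image fun μ : Fin d => s - Pi.single μ 1)
    have h2 : (Finset.univ.image fun μ : Fin d => s - Pi.single μ 1).card ≤ d :=
      Finset.card_image_le.trans (by rw [Finset.card_univ, Fintype.card_fin])
    have : S.card ≤ d + 1 := h.trans (by omega)
    exact_mod_cast this
  calc ∑' X, (if (X ∩ vertexStarZd s).Nonempty then g X else 0)
      ≤ ∑' X, ∑ v ∈ S, (if (∃ μ : Fin d, ((v, μ) : ZdEdge d) ∈ X) then g X else 0) := h1.tsum_le_tsum hdom hsumS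
    _ = ∑ v ∈ S, ∑' X, (if (∃ μ : Fin d, ((v, μ) : ZdEdge d) ∈ X) then g X else 0) :=
        Summable.tsum_finsetSum fun v _ => hlips v
    _ ≤ ∑ v ∈ S, ε₁ := Finset.sum_le_sum fun v _ => hlipa v
    _ = S.card * ε₁ := by rw [Finset.sum_const, nsmul_eq_mul]
    _ ≤ ((d : ℝ) + 1) * ε₁ := by
        have hε₁ : 0 ≤ ε₁ := le_trans (tsum_nonneg fun X => by split_ifs; exacts [hg0 X, le_rfl]) (hlipa s)
        exact mul_le_mul_of_nonneg_right hcard hε₁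

end Loads


end Summit.Ventures.YMGap.RobustBall

end
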